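import Summits.QuantumFields.YangMills.Theorems.TwistedTraceScaling.Negative.QuasimodeProfileRigidity
import Mathlib.Analysis.SpecialFunctions.Integrals.Basic
import HarnessLib

/-!
# R69 — A FLAT TRANSVERSE MODE KILLS THE FLAT POINCARÉ INEQUALITY `hflat`: the `a = 0` member of the Mehler family (constant ground state,
# contraction `ρ = 1`) has censored Poincaré constant `≥ (1−δ)·e·b·R/3` on the window `[−R, R]` — unbounded in the window — for EVERY mass
# slack `δ < 1`; the resampling block, by contrast, has Poincaré constant exactly `1`
# (crux `LuscherReduction.TwistedTraceScaling`, stmt-QuantumFields-20203; bears on the ONE remaining hypothesis `hflat` of the lead's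
# ✓`…BOStiffGapInputs.spec_gap_inputs_of_hflat` (g22), on hand w3's chain ✓`…BOStiffMehlerExit.mehler_poincare_box` →
# ✓`…BOStiffTensorPoincareSlack` → ✓`…BOStiffBoxBallExit.product_exit_mass_le` → ✓`…BOStiffFlatTensor.killed_transfer_door_slack` → `…BOStiffFlatPoincare`,
# and on hand w2's ✓`…BOStiffPiTransport.hflat_transport_cS`; sequel of ✓R63 `…Negative.CensoredPoincareKilling`, ✓R67 `…Negative.QuasimodeProfileRigidity`)

Standing-disprover cycle 56.  HONEST FRAMING: a load-bearing-hypothesis lemma about the OPEN flat Poincaré atom of a stub of a child of the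
CONDITIONAL route R2b1 — nothing landed is refuted; not a gap, not Clay.

THE ATOM.  `hflat`: `∃ M₁ ∀ M ≥ M₁ ∃ P₀ > 0 ∀ δ > 0 ∀ᶠ β ∀ g` (measurable, bounded, `= 0` off `cS L β`),
`∫_{cS} g²cD − (∫_{cS} g·cD)²/∫_{cS} cD ≤ P₀·½∫∫(g x − g y)²·cJ0 x y dπ dπ + δ·∫_{cS} g²cD`, with ✓`…BOStiffFlatDefs`: `cD = N̄·θ_Y·h²`,
`cJ0 = (θ_Y ⊗ θ_Y)·(h k h')·cZ/cIk`, `θ_Y = e^{−‖P_Γx̂‖²β²}`, `h = e^{−q_β}` (`q_β = stiffGaussExp L (β/2) β`), `k = e^{−(β/2)(S+S')}e^{−β‖P_⊥(x̂−x̂')‖²}`,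
support `cS L β = {‖x̂‖ ≤ r(β)}`, `r(β) = min(1/40, β^{-1/2}ℓ)`, `ℓ = btLog β → ∞`.  Per normal mode of `(β/2)H` on `P_⊥(linkEmbed Bal)` this is the
one-mode Mehler pair of ✓R67 (`a = (β/2)h_k`, `b = β`, `c = c_* = √(a²+2ab)`, contraction `ρ = b/(a+b+c)`, ✓`R67.mehlerRatio_eq_inv_denominator`) on a
window of half-width `≍ ℓ` in units of the kinetic step `β^{-1/2}`, tensorised with the gauge block `(θ_Y, θ_Y ⊗ θ_Y)`.
THIS FILE: what happens in a transverse direction in which the stiff Hessian vanishes (`h_k = 0`, so `a = c = 0`, `h ≡ 1`, `ρ = 1`).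
* §1 `flat_groundState_const` — at `a = c = 0` the constant IS the exact ground state, level `√(π/b)` (✓R67 at the degenerate datum): nothing in the
  profile detects the flat direction; only the Poincaré constant does.
* §2–§3 moments of the flat weight on `T = [−R,R]` and the pointwise bound `u²e^{−bu²} ≤ 1/(e·b)` ⇒ the censored jump form of the LINEAR test
  function `g(x) = x` is `≤ (2R)²·c/(e·b)` while its variance is `d·2R³/3`.
* §4 ★★★ `poincare_constant_ge_of_flat` — if the censored flat inequality with weight `D ≡ d`, jump `J(x,y) = c·e^{−b(x−y)²}` (any amplitudes
  `d, c > 0`, any `P₀ ≥ 0`, any slack `δ`) holds on `[−R,R]` for `g(x) = x`, then `(1−δ)·d·e·b·R ≤ 3c·P₀`; ★★★ `flat_poincare_fails` (contrapositive) and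
  ★★ `flat_poincare_eventually_fails` (`δ < 1` ⇒ fails for all large `R`); ★★ `no_windowUniform_flat_poincare` — in the `hflat` currency
  (`∃ P₀ ∀ δ > 0 ∀ᶠ R`) and even with `P₀` ALLOWED TO DEPEND ON `δ < 1` (`no_flat_poincare_of_slack`) there is NO window-uniform constant.
* §5 ★ `resampling_poincare_eq` — CONTRAST: for the resampling kernel `J(x,y) = D(x)D(y)/∫D` (any finite measure space, bounded measurable `D ≥ 0`,
  `∫D > 0`, bounded measurable `g`) the jump form EQUALS the variance: Poincaré constant exactly `1`, no slack, on every window.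
READING (lattice; checks for w3's `…BOStiffFlatPoincare` instantiation and the lead's `…BOStiffFlatBridge`).  In the `b`-normalised coordinate of a
transverse mode the window of `hflat` has half-width `R ≍ ℓ = btLog β → ∞`, so by §4 a single transverse direction of `linkEmbed(balancedSet L)` lying in
`ker H ⊖ gaugeModes` would make `hflat` FALSE for every β-free `P₀` and every `δ < 1` (admissible witness: `g = ⟨e_k, x̂⟩·𝟙_{cS}`, bounded, measurable,
vanishing off `cS`).  The gauge directions are ALSO in `ker H`; they survive only because they enter `cK` with NO kinetic Gaussian (full based-gauge
reach, ✓`cM_lower`) and `cD` with the `θ_Y`-confinement at scale `β^{-1} ≪ r(β)` — the RESAMPLING block of §5 (`P₀ = 1`), not a flat Mehler mode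
(regimes (ay)(iii), (az)(vi) of the work file).  Hence LOAD-BEARING for any proof of `hflat`: (H) ✓`…VacuumHodge.ker_covCurl_one_le`
(`ker d ⊆ constModes ⊔ gaugeModes`: the discrete `H¹((ℤ/L)³; ℝ³) = ℝ⁹` is carried by the constant modes, which `balancedSet` moves into the slow
variable `u`) together with the coercivity of `H` on `(constModes ⊔ gaugeModes)ᗮ` (`h_k ≥ g_L := 2 − 2cos(2π/L)`, ✓`…BOShellCoercive.shell_exponent_ge_of_hodge`),
giving `ρ_k ≤ ρ(L) = 1/(1 + g_L/2 + √(g_L²/4 + g_L)) < 1` for EVERY stiff coordinate; concretely (i) the linear parametrisation `T : ℝ^σ × Γ → (Edge → ℝ³)`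
with `Set.range T = balancedSet L` demanded by ✓`hflat_transport_cS_map` exists only with `σ = dim Bal − dim Γ = rank H|_{Bal}` — cite (H), do not
posit it; (ii) every `a_k` fed to ✓`mehler_poincare_box` / ✓`product_exit_mass_le` must be `(β/2)h_k` with `h_k ≥ g_L`, so `P₀ = max(1, 1/(1−ρ(L)))`
is β-free but NOT L-free (`1 − ρ(L) ≍ √g_L ≍ 2π/L`, consistent with ✓R60/✓R61: no L-uniform stiff constant); (iii) the slack `δ` cannot stand in for
contraction (§4 holds for every `δ < 1`), it only absorbs the exit mass `P₀·ε_R` of ✓`killed_transfer_door_slack`.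
VERDICT 56: no kill — with (H) in the tree the transverse chain has no flat mode and `hflat` stays plausible TRUE; R69 states what its proof must use.
[folklore] (harmonic/Mehler transfer kernel: [cite: Wipf2021, §8.5.1 (8.56)–(8.58)]; part process and killing: [cite: FukushimaOshimaTakeda2011, §4.4]).
-/

set_option autoImplicit false

noncomputable section

open Real MeasureTheory Set Filter

namespace Summit.QuantumFields.YangMills.Theorems.TwistedTraceScaling.Negative.R69

open Summit.QuantumFields.YangMills.Theorems.TwistedTraceScaling.Negative.R67

/-! ## §1 The flat member of the Mehler family: constant ground state, level `√(π/b)`, contraction `1` -/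

/-- At `a = c = 0` (a transverse direction with vanishing stiff Hessian) the constant profile is reproduced exactly by the kinetic kernel:
`∫ e^{−b(x−y)²} dy = √(π/b)` for every `x` — the degenerate case of ✓`R67.mehler_gaussian_exact` (`c_*² = a² + 2ab = 0`). [cite: Wipf2021, §8.5.1 (8.56)–(8.58)] -/
theorem flat_groundState_const {b : ℝ} (hb : 0 < b) (x : ℝ) :
    ∫ y, Real.exp (-(b * (x - y) ^ 2)) = Real.sqrt (π / b) := by
  have h := mehler_gaussian_exact (a := 0) (b := b) (c := 0) (by linarith) (by ring) x
  simpa using h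

/-- The flat datum has NO contraction: `ρ = b/(a+b+c) = 1` at `a = c = 0` (every genuine stiff mode has `ρ < 1`,
✓`R67.mehlerRatio_eq_inv_denominator`). [folklore] -/
theorem flat_contraction_eq_one {b : ℝ} (hb : 0 < b) : b / (0 + b + 0) = 1 := by
  rw [zero_add, add_zero, div_self hb.ne']

/-! ## §2 Moments of the flat weight on the window `T = [−R, R]` -/

/-- `∫_{[−R,R]} K = 2R·K`. [folklore] -/
theorem integral_Icc_const {R : ℝ} (hR : 0 ≤ R) (K : ℝ) : ∫ _x in Icc (-R) R, K = 2 * R * K := by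
  rw [integral_Icc_eq_integral_Ioc, ← intervalIntegral.integral_of_le (by linarith : -R ≤ R), intervalIntegral.integral_const, smul_eq_mul]
  ring

/-- `∫_{[−R,R]} x dx = 0`. [folklore] -/
theorem integral_Icc_id {R : ℝ} (hR : 0 ≤ R) : ∫ x in Icc (-R) R, x = 0 := by
  rw [integral_Icc_eq_integral_Ioc, ← intervalIntegral.integral_of_le (by linarith : -R ≤ R), integral_id]
  ring

/-- `∫_{[−R,R]} x² dx = 2R³/3`. [folklore] -/
theorem integral_Icc_sq {R : ℝ} (hR : 0 ≤ R) : ∫ x in Icc (-R) R, x ^ 2 = 2 * R ^ 3 / 3 := by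
  rw [integral_Icc_eq_integral_Ioc, ← intervalIntegral.integral_of_le (by linarith : -R ≤ R), integral_pow]
  push_cast
  ring

/-- `∫_{[−R,R]} x²·d dx = d·2R³/3`. [folklore] -/
theorem integral_Icc_sq_mul {R : ℝ} (hR : 0 ≤ R) (d : ℝ) : ∫ x in Icc (-R) R, x ^ 2 * d = d * (2 * R ^ 3 / 3) := by
  rw [integral_mul_const, integral_Icc_sq hR]; ring

/-- `∫_{[−R,R]} x·d dx = 0`. [folklore] -/
theorem integral_Icc_id_mul {R : ℝ} (hR : 0 ≤ R) (d : ℝ) : ∫ x in Icc (-R) R, x * d = 0 := by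
  rw [integral_mul_const, integral_Icc_id hR, zero_mul]

/-! ## §3 The censored jump form of the linear test function is `O(R²)` in the flat direction -/

/-- `t·e^{−t} ≤ e^{−1}` for all real `t` (tangent line of `exp` at `t = 1`). [folklore] -/
theorem mul_exp_neg_le (t : ℝ) : t * Real.exp (-t) ≤ Real.exp (-1) := by
  have h1 : t ≤ Real.exp (t - 1) := by have := Real.add_one_le_exp (t - 1); linarith
  have h2 : Real.exp (t - 1) * Real.exp (-t) = Real.exp (-1) := by rw [← Real.exp_add]; ring_nf
  calc t * Real.exp (-t) ≤ Real.exp (t - 1) * Real.exp (-t) := mul_le_mul_of_nonneg_right h1 (Real.exp_pos _).le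
    _ = Real.exp (-1) := h2

/-- ★ Pointwise: `u²·e^{−b u²} ≤ e^{−1}/b` (`b > 0`) — the flat jump integrand never exceeds `1/(e b)`, however far the jump. [folklore] -/
theorem sq_mul_exp_neg_le {b : ℝ} (hb : 0 < b) (u : ℝ) : u ^ 2 * Real.exp (-(b * u ^ 2)) ≤ Real.exp (-1) / b := by
  have h := mul_exp_neg_le (b * u ^ 2)
  rw [le_div_iff₀ hb]
  calc u ^ 2 * Real.exp (-(b * u ^ 2)) * b = b * u ^ 2 * Real.exp (-(b * u ^ 2)) := by ring
    _ ≤ Real.exp (-1) := h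

/-- With an amplitude `c ≥ 0`: `(x−y)²·(c·e^{−b(x−y)²}) ≤ c·e^{−1}/b`. [folklore] -/
theorem jumpIntegrand_le {b c : ℝ} (hb : 0 < b) (hc : 0 ≤ c) (x y : ℝ) :
    (x - y) ^ 2 * (c * Real.exp (-(b * (x - y) ^ 2))) ≤ c * (Real.exp (-1) / b) := by
  have h := sq_mul_exp_neg_le hb (x - y)
  calc (x - y) ^ 2 * (c * Real.exp (-(b * (x - y) ^ 2))) = c * ((x - y) ^ 2 * Real.exp (-(b * (x - y) ^ 2))) := by ring
    _ ≤ c * (Real.exp (-1) / b) := mul_le_mul_of_nonneg_left h hc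

/-- The flat jump integrand is non-negative. [folklore] -/
theorem jumpIntegrand_nonneg {b c : ℝ} (hc : 0 ≤ c) (x y : ℝ) : 0 ≤ (x - y) ^ 2 * (c * Real.exp (-(b * (x - y) ^ 2))) :=
  mul_nonneg (sq_nonneg _) (mul_nonneg hc (Real.exp_pos _).le)

/-- ★ Rows of the censored flat jump form: `∫_{[−R,R]} (x−y)²·c e^{−b(x−y)²} dy ≤ 2R·c·e^{−1}/b`. [folklore] -/
theorem jumpRow_flat_le {b c R : ℝ} (hb : 0 < b) (hc : 0 ≤ c) (hR : 0 ≤ R) (x : ℝ) :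
    ∫ y in Icc (-R) R, (x - y) ^ 2 * (c * Real.exp (-(b * (x - y) ^ 2))) ≤ 2 * R * (c * (Real.exp (-1) / b)) := by
  rw [← integral_Icc_const hR]
  refine integral_mono_of_nonneg (ae_of_all _ fun y => jumpIntegrand_nonneg hc x y) (integrable_const _)
    (ae_of_all _ fun y => jumpIntegrand_le hb hc x y)

/-- ★★ THE CENSORED FLAT JUMP FORM OF `g = id` IS `O(R²)`: `∫_{[−R,R]}∫_{[−R,R]} (x−y)²·c e^{−b(x−y)²} ≤ (2R)²·c·e^{−1}/b`. [folklore] -/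
theorem jumpForm_flat_le {b c R : ℝ} (hb : 0 < b) (hc : 0 ≤ c) (hR : 0 ≤ R) :
    ∫ x in Icc (-R) R, ∫ y in Icc (-R) R, (x - y) ^ 2 * (c * Real.exp (-(b * (x - y) ^ 2))) ≤ (2 * R) ^ 2 * (c * (Real.exp (-1) / b)) := by
  have h : ∫ x in Icc (-R) R, ∫ y in Icc (-R) R, (x - y) ^ 2 * (c * Real.exp (-(b * (x - y) ^ 2))) ≤
      ∫ _x in Icc (-R) R, 2 * R * (c * (Real.exp (-1) / b)) :=
    integral_mono_of_nonneg (ae_of_all _ fun x => integral_nonneg fun y => jumpIntegrand_nonneg hc x y) (integrable_const _)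
      (ae_of_all _ fun x => jumpRow_flat_le hb hc hR x)
  rw [integral_Icc_const hR] at h
  calc _ ≤ 2 * R * (2 * R * (c * (Real.exp (-1) / b))) := h
    _ = (2 * R) ^ 2 * (c * (Real.exp (-1) / b)) := by ring

/-! ## §4 ★★★ The censored flat Poincaré inequality with a mass slack FAILS on large windows -/

/-- ★★★ **POINCARÉ CONSTANT OF A FLAT MODE GROWS WITH THE WINDOW.**  Constant weight `D ≡ d` on `T = [−R,R]` (the squared ground state of the
flat datum is constant; the sign of `d` is immaterial for this direction), censored jump `J(x,y) = c·e^{−b(x−y)²}` on `T × T` (`b, c > 0`), any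
`P₀ ≥ 0`, any slack `δ`: if the `hflat`-shaped inequality `Var_T^D(g) ≤ P₀·½∫_T∫_T (g x − g y)²J + δ·∫_T g²D` holds for the linear test function
`g(x) = x`, then `(1−δ)·d·e·b·R ≤ 3c·P₀` — i.e. for `d > 0`, `δ < 1`: `P₀ ≥ (1−δ)·(d/c)·(e·b/3)·R`. [cite: FukushimaOshimaTakeda2011, §4.4] -/
theorem poincare_constant_ge_of_flat {b d c P₀ δ R : ℝ} (hb : 0 < b) (hc : 0 < c) (hP : 0 ≤ P₀) (hR : 0 < R)
    (h : (∫ x in Icc (-R) R, x ^ 2 * d) - (∫ x in Icc (-R) R, x * d) ^ 2 / (∫ _x in Icc (-R) R, d) ≤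
        P₀ * ((1 / 2) * ∫ x in Icc (-R) R, ∫ y in Icc (-R) R, (x - y) ^ 2 * (c * Real.exp (-(b * (x - y) ^ 2)))) +
          δ * ∫ x in Icc (-R) R, x ^ 2 * d) :
    (1 - δ) * d * (Real.exp 1 * b) * R ≤ 3 * c * P₀ := by
  rw [integral_Icc_sq_mul hR.le, integral_Icc_id_mul hR.le, integral_Icc_const hR.le] at h
  set K := Real.exp (-1) / b with hKdef
  have hKpos : 0 < K := div_pos (Real.exp_pos _) hb
  have hE := jumpForm_flat_le hb hc.le hR.le
  have hE' : P₀ * ((1 / 2) * ∫ x in Icc (-R) R, ∫ y in Icc (-R) R, (x - y) ^ 2 * (c * Real.exp (-(b * (x - y) ^ 2)))) ≤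
      P₀ * ((1 / 2) * ((2 * R) ^ 2 * (c * K))) :=
    mul_le_mul_of_nonneg_left (mul_le_mul_of_nonneg_left hE (by norm_num)) hP
  have h0 : (0:ℝ) ^ 2 / (2 * R * d) = 0 := by simp
  rw [h0, sub_zero] at h
  -- `(1−δ)·d·2R³/3 ≤ 2P₀R²·cK`, i.e. after dividing by `2R²/3 > 0`: `(1−δ)·d·R ≤ 3cP₀·K`
  have h1 : (1 - δ) * d * R * (2 * R ^ 2 / 3) ≤ 3 * c * P₀ * K * (2 * R ^ 2 / 3) := by
    calc (1 - δ) * d * R * (2 * R ^ 2 / 3) = (1 - δ) * (d * (2 * R ^ 3 / 3)) := by ring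
      _ ≤ P₀ * ((1 / 2) * ((2 * R) ^ 2 * (c * K))) := by linarith
      _ = 3 * c * P₀ * K * (2 * R ^ 2 / 3) := by ring
  have h2 : (1 - δ) * d * R ≤ 3 * c * P₀ * K := le_of_mul_le_mul_right h1 (by positivity)
  -- `e·b = 1/K`
  have hK : Real.exp 1 * b = K⁻¹ := by
    rw [hKdef, Real.exp_neg, inv_div, div_eq_mul_inv, inv_inv, mul_comm]
  rw [hK]
  calc (1 - δ) * d * K⁻¹ * R = (1 - δ) * d * R / K := by ring
    _ ≤ 3 * c * P₀ * K / K := div_le_div_of_nonneg_right h2 hKpos.le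
    _ = 3 * c * P₀ := by field_simp

/-- ★★★ **THE FLAT POINCARÉ INEQUALITY FAILS** as soon as `(1−δ)·d·e·b·R > 3c·P₀` (so for every `δ < 1` on all large windows). [cite: FukushimaOshimaTakeda2011, §4.4] -/
theorem flat_poincare_fails {b d c P₀ δ R : ℝ} (hb : 0 < b) (hc : 0 < c) (hP : 0 ≤ P₀) (hR : 0 < R)
    (hbig : 3 * c * P₀ < (1 - δ) * d * (Real.exp 1 * b) * R) :
    ¬ ((∫ x in Icc (-R) R, x ^ 2 * d) - (∫ x in Icc (-R) R, x * d) ^ 2 / (∫ _x in Icc (-R) R, d) ≤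
        P₀ * ((1 / 2) * ∫ x in Icc (-R) R, ∫ y in Icc (-R) R, (x - y) ^ 2 * (c * Real.exp (-(b * (x - y) ^ 2)))) +
          δ * ∫ x in Icc (-R) R, x ^ 2 * d) :=
  fun h => absurd (poincare_constant_ge_of_flat hb hc hP hR h) (not_le.2 hbig)

/-- ★★ For every slack `δ < 1` and every `P₀ ≥ 0` the flat inequality fails on ALL LARGE WINDOWS. [folklore] -/
theorem flat_poincare_eventually_fails {b d c P₀ δ : ℝ} (hb : 0 < b) (hd : 0 < d) (hc : 0 < c) (hP : 0 ≤ P₀) (hδ : δ < 1) :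
    ∀ᶠ R : ℝ in atTop, ¬ ((∫ x in Icc (-R) R, x ^ 2 * d) - (∫ x in Icc (-R) R, x * d) ^ 2 / (∫ _x in Icc (-R) R, d) ≤
        P₀ * ((1 / 2) * ∫ x in Icc (-R) R, ∫ y in Icc (-R) R, (x - y) ^ 2 * (c * Real.exp (-(b * (x - y) ^ 2)))) +
          δ * ∫ x in Icc (-R) R, x ^ 2 * d) := by
  have hδ' : 0 < 1 - δ := by linarith
  have hpos : 0 < (1 - δ) * d * (Real.exp 1 * b) := mul_pos (mul_pos hδ' hd) (mul_pos (Real.exp_pos _) hb)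
  filter_upwards [eventually_gt_atTop (3 * c * P₀ / ((1 - δ) * d * (Real.exp 1 * b))), eventually_gt_atTop (0 : ℝ)] with R hR hR0
  refine flat_poincare_fails hb hc hP hR0 ?_
  rw [div_lt_iff₀ hpos] at hR
  linarith

/-- ★★ **NO WINDOW-UNIFORM CONSTANT, EVEN WITH `P₀` DEPENDING ON THE SLACK**: for each `δ < 1` there is no `P₀ ≥ 0` for which the flat inequality
holds eventually in the window size. [folklore] -/
theorem no_flat_poincare_of_slack {b d c δ : ℝ} (hb : 0 < b) (hd : 0 < d) (hc : 0 < c) (hδ : δ < 1) :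
    ¬ ∃ P₀ : ℝ, 0 ≤ P₀ ∧ ∀ᶠ R : ℝ in atTop,
      (∫ x in Icc (-R) R, x ^ 2 * d) - (∫ x in Icc (-R) R, x * d) ^ 2 / (∫ _x in Icc (-R) R, d) ≤
        P₀ * ((1 / 2) * ∫ x in Icc (-R) R, ∫ y in Icc (-R) R, (x - y) ^ 2 * (c * Real.exp (-(b * (x - y) ^ 2)))) +
          δ * ∫ x in Icc (-R) R, x ^ 2 * d := by
  rintro ⟨P₀, hP, hev⟩
  obtain ⟨R, hR, hR'⟩ := (hev.and (flat_poincare_eventually_fails hb hd hc hP hδ)).exists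
  exact hR' hR

/-- ★★ **THE `hflat` CURRENCY** (`∃ P₀ ∀ δ > 0 ∀ᶠ window`): no such constant exists for a flat mode. [folklore] -/
theorem no_windowUniform_flat_poincare {b d c : ℝ} (hb : 0 < b) (hd : 0 < d) (hc : 0 < c) :
    ¬ ∃ P₀ : ℝ, 0 < P₀ ∧ ∀ δ : ℝ, 0 < δ → ∀ᶠ R : ℝ in atTop,
      (∫ x in Icc (-R) R, x ^ 2 * d) - (∫ x in Icc (-R) R, x * d) ^ 2 / (∫ _x in Icc (-R) R, d) ≤
        P₀ * ((1 / 2) * ∫ x in Icc (-R) R, ∫ y in Icc (-R) R, (x - y) ^ 2 * (c * Real.exp (-(b * (x - y) ^ 2)))) +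
          δ * ∫ x in Icc (-R) R, x ^ 2 * d := by
  rintro ⟨P₀, hP, h⟩
  exact no_flat_poincare_of_slack hb hd hc (by norm_num : (1:ℝ) / 2 < 1) ⟨P₀, hP.le, h (1 / 2) (by norm_num)⟩

/-! ## §5 CONTRAST: the resampling block (gauge directions) has Poincaré constant exactly `1` -/

section Resampling

variable {X : Type*} [MeasurableSpace X] {μ : Measure X} [IsFiniteMeasure μ]

/-- Bounded measurable functions are integrable against a finite measure. [folklore] -/
theorem integrable_of_abs_le {f : X → ℝ} {C : ℝ} (hf : Measurable f) (hb : ∀ x, |f x| ≤ C) : Integrable f μ :=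
  Integrable.mono' (integrable_const C) hf.aestronglyMeasurable (ae_of_all _ fun x => by rw [Real.norm_eq_abs]; exact hb x)

/-- ★ **RESAMPLING IDENTITY.**  For bounded measurable `D` with `∫D ≠ 0` and bounded measurable `g` on a finite measure space, the jump form of the
resampling kernel `J(x,y) = D(x)D(y)/∫D` IS the variance: `½∫∫(g x − g y)²·D x·D y/∫D = ∫g²D − (∫gD)²/∫D` — Poincaré constant exactly `1`, no slack,
on every window (the gauge block `θ_Y ⊗ θ_Y` of `cJ0`, cf. ✓`…BOStiffFlatTensor.productJump_eq`; contrast with §4). [folklore] -/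
theorem resampling_poincare_eq {g D : X → ℝ} {Cg CD : ℝ} (hg : Measurable g) (hgb : ∀ x, |g x| ≤ Cg) (hD : Measurable D)
    (hDb : ∀ x, |D x| ≤ CD) (hM : ∫ z, D z ∂μ ≠ 0) :
    (1 / 2) * ∫ x, ∫ y, (g x - g y) ^ 2 * (D x * D y / ∫ z, D z ∂μ) ∂μ ∂μ =
      (∫ x, g x ^ 2 * D x ∂μ) - (∫ x, g x * D x ∂μ) ^ 2 / ∫ z, D z ∂μ := by
  -- integrability of the bounded measurable pieces
  have iD : Integrable D μ := integrable_of_abs_le hD hDb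
  have igD : Integrable (fun y => g y * D y) μ := by
    refine integrable_of_abs_le (C := Cg * CD) (hg.mul hD) fun y => ?_
    rw [abs_mul]; exact mul_le_mul (hgb y) (hDb y) (abs_nonneg _) ((abs_nonneg _).trans (hgb y))
  have ig2D : Integrable (fun y => g y ^ 2 * D y) μ := by
    refine integrable_of_abs_le (C := Cg ^ 2 * CD) ((hg.pow_const 2).mul hD) fun y => ?_
    rw [abs_mul, abs_pow]
    exact mul_le_mul (pow_le_pow_left₀ (abs_nonneg _) (hgb y) 2) (hDb y) (abs_nonneg _) (pow_nonneg ((abs_nonneg _).trans (hgb y)) 2)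
  set M := ∫ z, D z ∂μ with hMdef
  set A := ∫ x, g x * D x ∂μ with hAdef
  set B := ∫ x, g x ^ 2 * D x ∂μ with hBdef
  -- the rows: `∫ (g x − g y)²·D x·D y/M dy = (D x/M)·(g x²·M − 2·g x·A + B)`
  have inner : ∀ x, ∫ y, (g x - g y) ^ 2 * (D x * D y / M) ∂μ = D x / M * (g x ^ 2 * M - 2 * g x * A + B) := by
    intro x
    have e1 : (fun y => (g x - g y) ^ 2 * (D x * D y / M)) =
        fun y => D x / M * (g x ^ 2 * D y - 2 * g x * (g y * D y) + g y ^ 2 * D y) := by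
      funext y; ring
    rw [e1, integral_const_mul, integral_add ((iD.const_mul _).sub' (igD.const_mul _)) ig2D,
      integral_sub (iD.const_mul _) (igD.const_mul _), integral_const_mul, integral_const_mul]
  have e2 : (fun x => ∫ y, (g x - g y) ^ 2 * (D x * D y / M) ∂μ) =
      fun x => B / M * D x - 2 * A / M * (g x * D x) + g x ^ 2 * D x := by
    funext x; rw [inner x]; field_simp; ring
  rw [e2, integral_add ((iD.const_mul _).sub' (igD.const_mul _)) ig2D, integral_sub (iD.const_mul _) (igD.const_mul _),
    integral_const_mul, integral_const_mul]
  field_simp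
  ring

/-- ★ Hence the resampling kernel satisfies the `hflat`-shaped inequality with `P₀ = 1` and `δ = 0` for EVERY bounded measurable test function —
the gauge directions of `ker H` cost nothing, the flat STIFF direction of §4 costs everything. [folklore] -/
theorem resampling_poincare_le {g D : X → ℝ} {Cg CD : ℝ} (hg : Measurable g) (hgb : ∀ x, |g x| ≤ Cg) (hD : Measurable D)
    (hDb : ∀ x, |D x| ≤ CD) (hM : ∫ z, D z ∂μ ≠ 0) :
    (∫ x, g x ^ 2 * D x ∂μ) - (∫ x, g x * D x ∂μ) ^ 2 / (∫ z, D z ∂μ) ≤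
      1 * ((1 / 2) * ∫ x, ∫ y, (g x - g y) ^ 2 * (D x * D y / ∫ z, D z ∂μ) ∂μ ∂μ) + 0 * ∫ x, g x ^ 2 * D x ∂μ := by
  rw [resampling_poincare_eq hg hgb hD hDb hM, one_mul, zero_mul, add_zero]

end Resampling

end Summit.QuantumFields.YangMills.Theorems.TwistedTraceScaling.Negative.R69

end
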